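import Literature.AlgebraicGeometry.Frobenioids.DivisorMonoidRightEqLeft
import Literature.AlgebraicGeometry.Frobenioids.MonoidTransport
import Literature.AlgebraicGeometry.Frobenioids.PrimaryStepsPrimeClasses
import HarnessLib

/-!
# [FrdI] Thm. 4.9, p. 89: "right-hand = left-hand" — from ONE isomorphism of monoids
# `Φ₁(A) ≅ Φ₂(Ψ A)` back to the prime-local slots `RightEqLeftAt`

Mochizuki, *The geometry of Frobenioids I: the general theory*, Kyushu J. Math. **62** (2008)
293–400, §4, proof of Theorem 4.9 (Kyushu text p. 370 ll. 8–17 and p. 371 ll. 2–5)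
[cite: MochizukiFrdI2008, Thm. 4.9 p.89]:

> "… it suffices to show that the right-hand and left-hand isomorphisms of Theorem 4.2 (iii)
> coincide … Since the right-hand and left-hand isomorphisms of Theorem 4.2 (iii) are clearly
> compatible with pull-back morphisms … we may assume without loss of generality that `A` is
> strictly rational."

PROOF-ONLY companion (seat abc-iut-w4-d099; no definitions, nothing asserted as a `Prop`), the
converse of `DivisorMonoidRightEqLeft.lean`: there, the prime-local slots
`∀ 𝔭, RightEqLeftAt F₁ F₂ Ψ A 𝔭 𝔭'` were glued into ONE isomorphism of monoids
`M : Φ₁(A) ≃* Φ₂(Ψ A)` with the right-hand property on all pre-steps out of `A` and the left-hand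
property on all pre-steps into `A`. Here, conversely, such an `M` RESTRICTS to the prime rays: for
primes `𝔭 ⊆ Φ₁(A)`, `𝔭' ⊆ Φ₂(Ψ A)` corresponding as in Thm. 4.2 (ii), clause (a)
[`Div φ ∈ 𝔭 ↔ Div(Ψ φ) ∈ 𝔭'`], `M` maps `𝔭.submonoid` onto `𝔭'.submonoid`
(`primes_congr_eq_of_div_mem_iff`: `𝔭' = M(𝔭)`), and its restriction witnesses
`RightEqLeftAt F₁ F₂ Ψ A 𝔭 𝔭'` (`rightEqLeftAt_of_mulEquiv`); with `DivisorMonoidRightEqLeft.lean`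
this gives the equivalence of the prime-local and the global forms of "right = left at `A`"
(`forall_rightEqLeftAt_iff_exists_mulEquiv`) — the form in which the reduction "WLOG `A` strictly
rational" (row T49-L05, transport along a pull-back morphism) hands its output back to row T49-L02.
Prime transport along `≃*`: `Primes.congr`, `Primes.submonoidCongr` (`MonoidTransport.lean`).
Nothing here bears on [IUTchIII].
-/

namespace Literature.AlgebraicGeometry.Frobenioids

open CategoryTheory Opposite

namespace FrdI.T49

universe w v v' u u'

variable {D₁ : Type u} [Category.{v} D₁] {Φ₁ : D₁ᵒᵖ ⥤ CommMonCat.{w}} {C₁ : Type u'} [Category.{v'} C₁]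
  {D₂ : Type u} [Category.{v} D₂] {Φ₂ : D₂ᵒᵖ ⥤ CommMonCat.{w}} {C₂ : Type u'} [Category.{v'} C₂]
  {F₁ : C₁ ⥤ ElemFrobenioid Φ₁} {F₂ : C₂ ⥤ ElemFrobenioid Φ₂} {Ψ : C₁ ≌ C₂}

/-- **The prime correspondence is induced by the monoid isomorphism**: if `M : Φ₁(A) ≃* Φ₂(Ψ A)`
computes `M(Div φ) = Div(Ψ φ)` on the pre-steps out of `A`, and `𝔭`, `𝔭'` correspond as in
Thm. 4.2 (ii), clause (a), on the co-angular pre-steps out of `A`, then `𝔭' = M(𝔭)`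
(every element of `𝔭` is a `Div φ`, Def. 1.3 (iii)(d)). [cite: MochizukiFrdI2008, Thm. 4.2 (ii) p.77] -/
theorem primes_congr_eq_of_div_mem_iff (hF₁ : PreFrobenioid.IsFrobenioid F₁) {A : C₁}
    (M : Φ₁.obj (op (PreFrobenioid.baseObj F₁ A)) ≃*
      Φ₂.obj (op (PreFrobenioid.baseObj F₂ (Ψ.functor.obj A))))
    (hMr : ∀ ⦃B : C₁⦄ (φ : A ⟶ B), PreFrobenioid.IsPreStep F₁ φ →
      M (PreFrobenioid.Div F₁ φ) = PreFrobenioid.Div F₂ (Ψ.functor.map φ))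
    (𝔭 : Primes (Φ₁.obj (op (PreFrobenioid.baseObj F₁ A))))
    (𝔭' : Primes (Φ₂.obj (op (PreFrobenioid.baseObj F₂ (Ψ.functor.obj A)))))
    (ha : ∀ ⦃B : C₁⦄ (φ : A ⟶ B), PreFrobenioid.IsCoAngularPreStep F₁ φ →
      (PreFrobenioid.Div F₁ φ ∈ 𝔭.submonoid ↔
        PreFrobenioid.Div F₂ (Ψ.functor.map φ) ∈ 𝔭'.submonoid)) :
    Primes.congr M 𝔭 = 𝔭' := by
  -- a primary representative `p` of `𝔭`, written `p = Div φ`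
  obtain ⟨⟨p, hp⟩, hp𝔭⟩ := Quotient.exists_rep 𝔭
  have hpc : p ∈ 𝔭.carrier := ⟨hp, hp𝔭⟩
  obtain ⟨B, φ, hφ, hφp⟩ := hF₁.iii_d_under_surj A p
  have h1 : M p ∈ (Primes.congr M 𝔭).carrier := by
    rw [Primes.carrier_congr]
    exact ⟨p, hpc, rfl⟩
  have h2 : M p ∈ 𝔭'.submonoid := by
    have h := (ha φ hφ).mp (by
      rw [hφp]
      exact (Primes.mem_submonoid_iff' 𝔭 p).mpr (Or.inr hpc))
    rwa [← hMr φ hφ.2, hφp] at h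
  have h3 : M p ∈ 𝔭'.carrier := by
    rcases (Primes.mem_submonoid_iff' 𝔭' (M p)).mp h2 with h | h
    · exact absurd (M.map_eq_one_iff.mp h) hp.1
    · exact h
  exact Primes.eq_of_mem_carrier h1 h3

/-- **Global ⇒ prime-local.** An isomorphism of monoids `M : Φ₁(A) ≃* Φ₂(Ψ A)` with the right-hand
property on the pre-steps out of `A` and the left-hand property on the pre-steps into `A` restricts,
for primes `𝔭`, `𝔭'` corresponding as in Thm. 4.2 (ii), clause (a), to a witness of
`RightEqLeftAt F₁ F₂ Ψ A 𝔭 𝔭'`. [cite: MochizukiFrdI2008, Thm. 4.9 p.89] -/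
theorem rightEqLeftAt_of_mulEquiv (hF₁ : PreFrobenioid.IsFrobenioid F₁) {A : C₁}
    (M : Φ₁.obj (op (PreFrobenioid.baseObj F₁ A)) ≃*
      Φ₂.obj (op (PreFrobenioid.baseObj F₂ (Ψ.functor.obj A))))
    (hMr : ∀ ⦃B : C₁⦄ (φ : A ⟶ B), PreFrobenioid.IsPreStep F₁ φ →
      M (PreFrobenioid.Div F₁ φ) = PreFrobenioid.Div F₂ (Ψ.functor.map φ))
    (hMl : ∀ ⦃B : C₁⦄ (ψ : B ⟶ A), PreFrobenioid.IsPreStep F₁ ψ →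
      ∀ y : Φ₁.obj (op (PreFrobenioid.baseObj F₁ A)),
        pull Φ₁ (PreFrobenioid.Base F₁ ψ) y = PreFrobenioid.Div F₁ ψ →
          pull Φ₂ (PreFrobenioid.Base F₂ (Ψ.functor.map ψ)) (M y) =
            PreFrobenioid.Div F₂ (Ψ.functor.map ψ))
    (𝔭 : Primes (Φ₁.obj (op (PreFrobenioid.baseObj F₁ A))))
    (𝔭' : Primes (Φ₂.obj (op (PreFrobenioid.baseObj F₂ (Ψ.functor.obj A)))))
    (ha : ∀ ⦃B : C₁⦄ (φ : A ⟶ B), PreFrobenioid.IsCoAngularPreStep F₁ φ →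
      (PreFrobenioid.Div F₁ φ ∈ 𝔭.submonoid ↔
        PreFrobenioid.Div F₂ (Ψ.functor.map φ) ∈ 𝔭'.submonoid)) :
    RightEqLeftAt F₁ F₂ Ψ A 𝔭 𝔭' := by
  have hc := primes_congr_eq_of_div_mem_iff hF₁ M hMr 𝔭 𝔭' ha
  unfold RightEqLeftAt
  refine ⟨Primes.submonoidCongr M 𝔭 𝔭' hc, fun B φ hφ h => ?_, fun B ψ hψ y hy hpull => ?_⟩
  · rw [Primes.coe_submonoidCongr_apply]
    exact hMr φ hφ.2
  · rw [Primes.coe_submonoidCongr_apply]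
    exact hMl ψ hψ.2 y hpull

/-- **Prime-local ⟺ global "right = left at `A`"** (with `DivisorMonoidRightEqLeft.lean`): in a
`T42.Setting`, for a prime correspondence `e𝔭` at `A` satisfying Thm. 4.2 (ii), clause (a) [e.g.
`Ψ^Prime(A)`], `RightEqLeftAt` holds at every `(A, 𝔭, e𝔭 𝔭)` iff ONE isomorphism of monoids
`Φ₁(A) ≃* Φ₂(Ψ A)` has the right-hand property on all pre-steps out of `A` and the left-hand property
on all pre-steps into `A`. [cite: MochizukiFrdI2008, Thm. 4.9 p.89] -/
theorem forall_rightEqLeftAt_iff_exists_mulEquiv (S : T42.Setting F₁ F₂ Ψ) {A : C₁}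
    (e𝔭 : Primes (Φ₁.obj (op (PreFrobenioid.baseObj F₁ A))) →
      Primes (Φ₂.obj (op (PreFrobenioid.baseObj F₂ (Ψ.functor.obj A)))))
    (ha : ∀ (𝔭 : Primes (Φ₁.obj (op (PreFrobenioid.baseObj F₁ A)))) ⦃B : C₁⦄ (φ : A ⟶ B),
      PreFrobenioid.IsCoAngularPreStep F₁ φ →
        (PreFrobenioid.Div F₁ φ ∈ 𝔭.submonoid ↔
          PreFrobenioid.Div F₂ (Ψ.functor.map φ) ∈ (e𝔭 𝔭).submonoid)) :
    (∀ 𝔭, RightEqLeftAt F₁ F₂ Ψ A 𝔭 (e𝔭 𝔭)) ↔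
      ∃ M : Φ₁.obj (op (PreFrobenioid.baseObj F₁ A)) ≃*
          Φ₂.obj (op (PreFrobenioid.baseObj F₂ (Ψ.functor.obj A))),
        (∀ ⦃B : C₁⦄ (φ : A ⟶ B), PreFrobenioid.IsPreStep F₁ φ →
            M (PreFrobenioid.Div F₁ φ) = PreFrobenioid.Div F₂ (Ψ.functor.map φ)) ∧
        ∀ ⦃B : C₁⦄ (ψ : B ⟶ A), PreFrobenioid.IsPreStep F₁ ψ →
          ∀ y : Φ₁.obj (op (PreFrobenioid.baseObj F₁ A)),
            pull Φ₁ (PreFrobenioid.Base F₁ ψ) y = PreFrobenioid.Div F₁ ψ →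
              pull Φ₂ (PreFrobenioid.Base F₂ (Ψ.functor.map ψ)) (M y) =
                PreFrobenioid.Div F₂ (Ψ.functor.map ψ) :=
  ⟨fun h => exists_mulEquiv_of_rightEqLeftAt S fun 𝔭 => ⟨e𝔭 𝔭, h 𝔭⟩,
    fun ⟨M, hMr, hMl⟩ 𝔭 => rightEqLeftAt_of_mulEquiv S.isFrobenioid₁ M hMr hMl 𝔭 (e𝔭 𝔭) (ha 𝔭)⟩

end FrdI.T49

end Literature.AlgebraicGeometry.Frobenioids
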